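import Mathlib
import Summits.QuantumFields.BalabanUV.Beta.AnalyticWalkSum216Algebra

/-!
# [Balaban1985BackgroundPropagators] (3.138) p. 423 «G₁ = G₀(I − (Δ′_π + Δ^{(2)}_π)G₀)⁻¹ = Σ_{n=0}^∞ G₀((Δ′_π + Δ^{(2)}_π)G₀)ⁿ»
# ∕ p. 422 «we replace each operator in (3.130) by its random walk expansion»: the NEUMANN SERIES of a walk-term family
# is a walk-term family — n-fold products over `Fin k → W`, the series over `Σ k, Fin k → W`, constant `(1 − Σρ)⁻¹`,
# and `termSum = (1 − A)⁻¹` entrywise (cell topic `Summits/QuantumFields/BalabanUV/Beta`; row-D4 leaves A.4.3∕A.4.6 and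
# route A.3′ rider (ρ3) of `OUTLINE-D4-NODE-A.md`, census `BETA/REMAINDER-BETA.md` §10)

HONEST FRAMING (cell rule).  Discharging `BetaPertH` makes Bałaban's UV stability UNCONDITIONAL — a real
constructive-QFT result; NOT the continuum limit, NOT the Clay problem.  This module discharges NOTHING of `BetaPertH`.
It is the [folklore] second half of the algebra of walk-term families begun in `AnalyticWalkSum216Algebra` (gen 37):
there, the termwise data `TermData` consumed by the (T1) reduction (`AnalyticWalkSum216`) were shown closed under sums,
scalars and PRODUCTS; here they are shown closed under the NEUMANN SERIES — the operation by which [13] Sect. D∕E builds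
`G`, `G₁`, `G₂` from `G₀` ((3.130), (3.138); p. 432 «perturbatively in the same way») and by which route A.3′ inverts
`1 + xK` on the unit lattice (d4-p3's `UnitLatticeWalkInversion.inv_one_add_eq_sum`).  With the sibling this makes the
sentence «products, sums, scalar multiples and Neumann series of expanded operators are expanded operators, with explicit
(2.16)-type data» a kernel theorem in the currency (T1) consumes.  Records-level: NO class change on (T2)∕(T3) — the
INPUT families (Bałaban's `G₀`-type expansions with their (3.108) majorants = NODE O.2 + leaf A.4.0; the perturbation
`Δ″` = leaves A.4.1∕A.4.2) are the located open inputs; NOT summit progress.  Unit `b2b-balaban-beta-an4-g37` (owner of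
`BINDER-OWNERS.md` row D4); cell `GAPS.md` C-an4-87.

CITATION HEADER (lean-in-tree rule).  [13] = T. Bałaban, *Propagators for lattice gauge theories in a background
field*, Commun. Math. Phys. **99**, 389–434 (1985) [Balaban1985BackgroundPropagators] (journal page = PDF page + 388;
renders `HOME/b2b-balaban-ref1/pages/1985-cmp99-background-propagators-p034∕p035∕p044-x2.png` READ AS IMAGES by this
lineage, gen 36).  p. 421 [PDF 33], verbatim: *"G = G₀(I − Δ′_πG₀)⁻¹ = Σ_{n=0}^∞ G₀(Δ′_πG₀)ⁿ. (3.130)"*; p. 422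
[PDF 34], verbatim: *"Of course Theorem 3.10 holds also because we replace each operator in (3.130) by its random walk
expansion. We do not have problems now with operators without small factors, because each operator Δ′_π provides the
small factor α₀, which we can choose to be arbitrarily small."*; p. 423 [PDF 35], verbatim: *"G₁ = G₀(I − (Δ′_π +
Δ^{(2)}_π)G₀)⁻¹ = Σ_{n=0}^∞ G₀((Δ′_π + Δ^{(2)}_π)G₀)ⁿ, (3.138)"* and *"the series (3.138) is convergent for α₀
restricted by a small, absolute constant. The convergence is in all norms appearing in the formulation of Theorem 3.3"*
(cell GAPS G-B9-16: the n-th-term bound is not written out in print); p. 432 [PDF 44], verbatim: *"Thus we can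
investigate the operator G₂ perturbatively in the same way as the operator G₁ in (3.138)."*  Nothing of [13] is asserted:
the displays LOCATE the operation (Neumann series of expanded operators) whose term bookkeeping is certified here on
hypothesis-families; the n-th-term BOUNDS of (3.138) in Thm 3.3's norms (G-B9-16) are NOT this file's subject — only
their (2.16)-currency shadow `Π ρ` is.

WHAT IS CERTIFIED HERE (kernel, sorry-free; [folklore]; notation of the sibling: `TermData κ d R T m ρw`, `prodTerm`,
`prodMaj`, `prodConst`; `s := Σ_w ρ_w`).
§1 `hasSum_pow_apply`: in the weighted-row-sum algebra (`B13PerturbativeStep`), `WRS κ d A ρ` with `ρ < 1` ⟹ the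
   ENTRYWISE Neumann series `Σ_k (A^k)(i,j)` converges to `((1 − A)⁻¹)(i,j)` (partial sums `(1 − A^N)(1 − A)⁻¹`,
   `geom_sum_mul_neg`; tail `≤ ρ^N(1 − ρ)⁻¹` by `WRS.pow`∕`WRS.inv_one_sub` BY NAME).
§2 `piTerm T k` (the ordered product of the terms along a `k`-sequence of walks, index `Fin k → W`), `piMaj`, `piConst
   = Π_t ρ_{l t}`; **`termData_piTerm`** (term data for every `k`, by the sibling's `prod` + `reindex` along
   `Fin.consEquiv`), `tsum_piConst` (`Σ_l Πρ = s^k`), **`termSum_piTerm`** (`termSum (piTerm T k) σ = (termSum T σ)^k`).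
§3 the NEUMANN FAMILY `neuTerm T ⟨k, l⟩ := piTerm T k l` on `Σ k, Fin k → W`: **`termData_neumann`** (term data with
   constants `neuConst`, summable since `Σ_k s^k < ∞` for `s ≤ ρ < 1` — Mathlib `summable_sigma_of_nonneg`),
   `tsum_neuConst` (`= (1 − s)⁻¹`), `tsum_neuConst_le` (`≤ (1 − ρ)⁻¹`), and **`termSum_neumann`**:
   `termSum (neuTerm T) σ = (1 − termSum T σ)⁻¹` on the disc (`Summable.tsum_sigma'` + §1 + §2) — so the (2.16)-shape
   ENDs of the sibling apply to the INVERSE BY NAME (`wrs_neumann_sub`: constant `2(1 − ρ)⁻¹/R·‖σ‖`).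
NOT CLAIMED.  Any expansion or majorant of Bałaban's operators; the n-th-term bounds of (3.138) in the norms
(3.42)–(3.47) (G-B9-16 — Hölder∕scale-weighted norms are not modelled by `WRS`); U-localisation of the terms (domains
= unions along the sequence; `DecouplingSupportWalks110`'s interface, not modelled here); multi-parameter analyticity.
NO class change on any GAPS row; NOT summit progress.
PRIOR ART IN THE TREE (searched 2026-08-20; nothing re-derived): `B13PerturbativeStep.WRS.inv_one_sub`∕`isUnit_one_sub`
(b13-g5: the Neumann BOUND without series — used BY NAME; the entrywise SERIES identity §1 is new); `DecayingKernelNeumann`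
(an4 gen 36: Neumann series in the decay currency on `ExpKernelCalculus`, no term structure, no parameter);
`UnitLatticeWalkInversion.inv_one_add_eq_sum` (d4-p3: the expansion to every FINITE order with a `WRS`-small remainder —
complementary: here the full series as ONE term family); `B9SectDWalk` (r1-g8: chains over real block-normed spaces);
`Literature/Analysis/Fourier/TorusProductSeries` (the `Fin.consEquiv` induction pattern for product series, re-used).
-/

namespace Summit.QuantumFields.BalabanUV.Beta.AnalyticWalkSum216Neumann

open Metric Set Filter Topology
open Literature.MathematicalPhysics.QuantumFieldTheory.Balaban1983to89
open B13PerturbativeStep (WRS WeightHyp)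
open Summit.QuantumFields.BalabanUV.Beta.AnalyticWalkSum216 (termSum)
open Summit.QuantumFields.BalabanUV.Beta.AnalyticWalkSum216Algebra (TermData prodTerm prodMaj prodConst
  termSum_prod termSum_reindex tsum_prodConst)

noncomputable section

variable {n : Type*} [Fintype n] [DecidableEq n] {W : Type*} {κ : ℝ} {d : n → n → ℝ} {R : ℝ}

/-! ## §1 The entrywise Neumann series in the weighted-row-sum algebra -/

/-- Entries of powers: `‖(A^k)(i,j)‖ ≤ ρ^k` (`WRS.pow` BY NAME). [folklore] -/
theorem norm_pow_apply_le (hw : WeightHyp κ d) {A : Matrix n n ℂ} {ρ : ℝ} (hA : WRS κ d A ρ) (k : ℕ) (i j : n) :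
    ‖(A ^ k) i j‖ ≤ ρ ^ k :=
  B13PerturbativeStep.WRS.norm_apply_le' hw (hA.pow hw k) i j

/-- Partial sums of the matrix geometric series: `Σ_{k<N} A^k = (1 − A^N)(1 − A)⁻¹` for invertible `1 − A`. [folklore] -/
theorem geom_sum_eq (A : Matrix n n ℂ) (hU : IsUnit (1 - A)) (N : ℕ) :
    ∑ k ∈ Finset.range N, A ^ k = (1 - A ^ N) * (1 - A)⁻¹ := by
  have hdet : IsUnit (1 - A).det := (Matrix.isUnit_iff_isUnit_det _).mp hU
  rw [← geom_sum_mul_neg A N, Matrix.mul_assoc, Matrix.mul_nonsing_inv _ hdet, Matrix.mul_one]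

/-- **The ENTRYWISE NEUMANN SERIES**: `WRS κ d A ρ`, `ρ < 1` ⟹ `Σ_k (A^k)(i,j) = ((1 − A)⁻¹)(i,j)` as a `HasSum` —
[13] (3.130)∕(3.138) «G = G₀(I − Δ′_πG₀)⁻¹ = Σ_n G₀(Δ′_πG₀)ⁿ» in the (2.16) currency (tail `ρ^N(1 − ρ)⁻¹ → 0`).
[cite: Balaban1985BackgroundPropagators, (3.130) p.421] -/
theorem hasSum_pow_apply (hw : WeightHyp κ d) {A : Matrix n n ℂ} {ρ : ℝ} (hA : WRS κ d A ρ) (hρ : ρ < 1)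
    (i j : n) : HasSum (fun k => (A ^ k) i j) ((1 - A)⁻¹ i j) := by
  have hρ0 : 0 ≤ ρ := hA.nonneg i
  have hnorm : Summable fun k => ‖(A ^ k) i j‖ :=
    .of_nonneg_of_le (fun _ => norm_nonneg _) (fun k => norm_pow_apply_le hw hA k i j)
      (summable_geometric_of_lt_one hρ0 hρ)
  rw [hasSum_iff_tendsto_nat_of_summable_norm hnorm]
  have hU : IsUnit (1 - A) := B13PerturbativeStep.isUnit_one_sub hw hA hρ
  have hpart : ∀ N, ∑ k ∈ Finset.range N, (A ^ k) i j = (1 - A)⁻¹ i j - (A ^ N * (1 - A)⁻¹) i j := fun N => by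
    rw [← Matrix.sum_apply, geom_sum_eq A hU N, Matrix.sub_mul, Matrix.one_mul, Matrix.sub_apply]
  simp_rw [hpart]
  have hK : WRS κ d (1 - A)⁻¹ (1 - ρ)⁻¹ := hA.inv_one_sub hw hρ
  have htail : Tendsto (fun N => (A ^ N * (1 - A)⁻¹) i j) atTop (𝓝 0) := by
    refine squeeze_zero_norm (fun N => B13PerturbativeStep.WRS.norm_apply_le' hw ((hA.pow hw N).mul hw hK) i j) ?_
    simpa using (tendsto_pow_atTop_nhds_zero_of_lt_one hρ0 hρ).mul_const (1 - ρ)⁻¹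
  simpa using tendsto_const_nhds.sub htail

/-! ## §2 Ordered products along a sequence of walks -/

/-- The ordered PRODUCT of the terms along a `k`-sequence of walks `l : Fin k → W`:
`T_{l 0}(σ)·T_{l 1}(σ)⋯T_{l (k−1)}(σ)` (`k = 0`: the identity) — a term of the `k`-th Neumann order ([13] (3.138):
`G₀(Δ″G₀)ⁿ` expanded factor by factor). [cite: Balaban1985BackgroundPropagators, (3.138) p.423] -/
def piTerm (T : W → ℂ → Matrix n n ℂ) : (k : ℕ) → (Fin k → W) → ℂ → Matrix n n ℂ
  | 0 => fun _ _ => 1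
  | k + 1 => fun l σ => T (l 0) σ * piTerm T k (Fin.tail l) σ

/-- The majorant of `piTerm`: the ordered product of the majorants (`k = 0`: the identity matrix). [folklore] -/
def piMaj (m : W → n → n → ℝ) : (k : ℕ) → (Fin k → W) → n → n → ℝ
  | 0 => fun _ i j => (1 : Matrix n n ℝ) i j
  | k + 1 => fun l i j => ∑ c, m (l 0) i c * piMaj m k (Fin.tail l) c j

/-- The constant of `piTerm`: `Π_t ρ_{l t}`. [folklore] -/
def piConst (ρw : W → ℝ) (k : ℕ) (l : Fin k → W) : ℝ := ∏ t, ρw (l t)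

/-- The splitting equivalence `(Fin (k+1) → W) ≃ W × (Fin k → W)`, `l ↦ (l 0, tail l)`. [folklore] -/
abbrev split (W : Type*) (k : ℕ) : (Fin (k + 1) → W) ≃ W × (Fin k → W) := (Fin.consEquiv fun _ => W).symm

/-- `piTerm (k+1)` is the product family of `T` and `piTerm k`, re-indexed by the splitting. [folklore] -/
theorem piTerm_succ (T : W → ℂ → Matrix n n ℂ) (k : ℕ) :
    piTerm T (k + 1) = fun l => prodTerm T (piTerm T k) (split W k l) := rfl

/-- `piMaj (k+1)` is the product majorant, re-indexed by the splitting. [folklore] -/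
theorem piMaj_succ (m : W → n → n → ℝ) (k : ℕ) :
    piMaj m (k + 1) = fun l => prodMaj m (piMaj m k) (split W k l) := rfl

/-- `piConst (k+1)` is the product constant, re-indexed by the splitting (`Fin.prod_univ_succ`). [folklore] -/
theorem piConst_succ (ρw : W → ℝ) (k : ℕ) :
    piConst ρw (k + 1) = fun l => prodConst ρw (piConst ρw k) (split W k l) := by
  funext l
  simp only [piConst, Fin.prod_univ_succ, AnalyticWalkSum216Algebra.prodConst_apply]
  rfl

variable {T : W → ℂ → Matrix n n ℂ} {m : W → n → n → ℝ} {ρw : W → ℝ}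

/-- The identity family (one term `1`, majorant `1`, constant `1`) has term data. [folklore] -/
theorem termData_one (hw : WeightHyp κ d) {ι : Type*} [Finite ι] :
    TermData κ d R (fun (_ : ι) (_ : ℂ) => (1 : Matrix n n ℂ)) (fun _ i j => (1 : Matrix n n ℝ) i j)
      (fun _ => (1 : ℝ)) where
  ha _ i j := differentiableOn_const _
  hm _ σ _ i j := by
    by_cases h : i = j
    · subst h; simp
    · simp [Matrix.one_apply_ne h]
  hrow _ i := by
    rw [Finset.sum_eq_single i (fun j _ hj => by rw [Matrix.one_apply_ne (Ne.symm hj), zero_mul])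
      (fun h => (h (Finset.mem_univ i)).elim), Matrix.one_apply_eq, hw.zero i, mul_zero, Real.exp_zero, one_mul]
  hρw := .of_finite

/-- **TERM DATA FOR EVERY NEUMANN ORDER**: the `k`-fold product family has term data with constants `Π_t ρ_{l t}`
(the sibling's `prod` + `reindex` along the splitting, inductively). [folklore] -/
theorem termData_piTerm [Nonempty n] (h : TermData κ d R T m ρw) (hw : WeightHyp κ d) (hR : 0 < R) :
    ∀ k, TermData κ d R (piTerm T k) (piMaj m k) (piConst ρw k)
  | 0 => by
    have h1 := termData_one (R := R) hw (ι := Fin 0 → W)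
    refine ⟨h1.ha, h1.hm, fun l i => (h1.hrow l i).trans_eq ?_, .of_finite⟩
    simp [piConst]
  | k + 1 => by
    rw [piTerm_succ, piMaj_succ, piConst_succ]
    exact (h.prod (termData_piTerm h hw hR k) hw hR).reindex (split W k)

/-- The constants of the `k`-th order sum to `s^k`, `s = Σ_w ρ_w`. [folklore] -/
theorem tsum_piConst [Nonempty n] (h : TermData κ d R T m ρw) (hw : WeightHyp κ d) (hR : 0 < R) :
    ∀ k, ∑' l, piConst ρw k l = (∑' w, ρw w) ^ k
  | 0 => by
    rw [tsum_fintype, Fintype.sum_unique, pow_zero]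
    simp [piConst]
  | k + 1 => by
    rw [piConst_succ, (split W k).tsum_eq (fun p => prodConst ρw (piConst ρw k) p),
      tsum_prodConst h (termData_piTerm h hw hR k) hR, tsum_piConst h hw hR k, pow_succ']

/-- **`termSum` OF THE `k`-TH ORDER IS THE `k`-TH POWER**: `termSum (piTerm T k) σ = (termSum T σ)^k` on the disc
(the sibling's `termSum_prod`, inductively). [cite: Balaban1985BackgroundPropagators, p.422 after (3.131)] -/
theorem termSum_piTerm [Nonempty n] (h : TermData κ d R T m ρw) (hw : WeightHyp κ d) (hR : 0 < R) {σ : ℂ}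
    (hσ : σ ∈ ball (0 : ℂ) R) : ∀ k, termSum (piTerm T k) σ = termSum T σ ^ k
  | 0 => by
    ext i j
    simp only [termSum, piTerm, pow_zero]
    rw [tsum_fintype, Fintype.sum_unique]
  | k + 1 => by
    rw [piTerm_succ, termSum_reindex (prodTerm T (piTerm T k)) (split W k) σ,
      termSum_prod h (termData_piTerm h hw hR k) hw hR hσ, termSum_piTerm h hw hR hσ k, pow_succ']

/-! ## §3 The Neumann family -/

/-- The NEUMANN FAMILY: all orders at once, index `Σ k, Fin k → W` (a walk of walks of every length). [folklore] -/
def neuTerm (T : W → ℂ → Matrix n n ℂ) : (Σ k, Fin k → W) → ℂ → Matrix n n ℂ := fun x => piTerm T x.1 x.2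

/-- Its majorant. [folklore] -/
def neuMaj (m : W → n → n → ℝ) : (Σ k, Fin k → W) → n → n → ℝ := fun x => piMaj m x.1 x.2

/-- Its constants `Π_t ρ_{l t}`. [folklore] -/
def neuConst (ρw : W → ℝ) : (Σ k, Fin k → W) → ℝ := fun x => piConst ρw x.1 x.2

/-- **THE NEUMANN SERIES OF A WALK-TERM FAMILY IS A WALK-TERM FAMILY**: term data for `neuTerm` with constants
`neuConst`, provided `Σ_w ρ_w ≤ ρ < 1` (summability over the sigma type: every order is summable with sum `s^k`,
and `Σ_k s^k < ∞`). [cite: Balaban1985BackgroundPropagators, (3.138) p.423] -/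
theorem termData_neumann [Nonempty n] (h : TermData κ d R T m ρw) (hw : WeightHyp κ d) (hR : 0 < R) {ρ : ℝ}
    (hρ : ∑' w, ρw w ≤ ρ) (hρ1 : ρ < 1) : TermData κ d R (neuTerm T) (neuMaj m) (neuConst ρw) := by
  have hP : ∀ k, TermData κ d R (piTerm T k) (piMaj m k) (piConst ρw k) := termData_piTerm h hw hR
  refine ⟨fun x => (hP x.1).ha x.2, fun x => (hP x.1).hm x.2, fun x => (hP x.1).hrow x.2, ?_⟩
  have hnn : ∀ x : Σ k, Fin k → W, 0 ≤ neuConst ρw x := fun x => (hP x.1).ρw_nonneg hR x.2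
  have hfib : ∀ k, Summable fun l : Fin k → W => neuConst ρw ⟨k, l⟩ := fun k => (hP k).hρw
  have hsum : ∀ k, (∑' w, ρw w) ^ k = ∑' l : Fin k → W, neuConst ρw ⟨k, l⟩ :=
    fun k => (tsum_piConst h hw hR k).symm
  refine (summable_sigma_of_nonneg hnn).2 ⟨hfib, ?_⟩
  exact (summable_geometric_of_lt_one (h.tsum_ρw_nonneg hR) (hρ.trans_lt hρ1)).congr hsum

/-- The Neumann constants sum to `(1 − s)⁻¹`, `s = Σ_w ρ_w`. [folklore] -/
theorem tsum_neuConst [Nonempty n] (h : TermData κ d R T m ρw) (hw : WeightHyp κ d) (hR : 0 < R) {ρ : ℝ}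
    (hρ : ∑' w, ρw w ≤ ρ) (hρ1 : ρ < 1) : ∑' x, neuConst ρw x = (1 - ∑' w, ρw w)⁻¹ := by
  have hP : ∀ k, TermData κ d R (piTerm T k) (piMaj m k) (piConst ρw k) := termData_piTerm h hw hR
  have hfib : ∀ k, Summable fun l : Fin k → W => neuConst ρw ⟨k, l⟩ := fun k => (hP k).hρw
  have htot : Summable (neuConst ρw) := (termData_neumann h hw hR hρ hρ1).hρw
  have hsum : ∀ k, ∑' l : Fin k → W, neuConst ρw ⟨k, l⟩ = (∑' w, ρw w) ^ k :=
    fun k => tsum_piConst h hw hR k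
  rw [htot.tsum_sigma' hfib, tsum_congr hsum]
  exact tsum_geometric_of_lt_one (h.tsum_ρw_nonneg hR) (hρ.trans_lt hρ1)

/-- Hence `Σ_x neuConst x ≤ (1 − ρ)⁻¹`. [folklore] -/
theorem tsum_neuConst_le [Nonempty n] (h : TermData κ d R T m ρw) (hw : WeightHyp κ d) (hR : 0 < R) {ρ : ℝ}
    (hρ : ∑' w, ρw w ≤ ρ) (hρ1 : ρ < 1) : ∑' x, neuConst ρw x ≤ (1 - ρ)⁻¹ := by
  rw [tsum_neuConst h hw hR hρ hρ1]
  exact inv_anti₀ (sub_pos.2 hρ1) (by linarith)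

/-- **`termSum` OF THE NEUMANN FAMILY IS THE INVERSE**: `termSum (neuTerm T) σ = (1 − termSum T σ)⁻¹` on the disc
([13] (3.130)∕(3.138) read as an identity of expansions: `Summable.tsum_sigma'` over the orders, §2 for each order, §1
for the entrywise geometric series). [cite: Balaban1985BackgroundPropagators, (3.138) p.423] -/
theorem termSum_neumann [Nonempty n] (h : TermData κ d R T m ρw) (hw : WeightHyp κ d) (hR : 0 < R) {ρ : ℝ}
    (hρ : ∑' w, ρw w ≤ ρ) (hρ1 : ρ < 1) {σ : ℂ} (hσ : σ ∈ ball (0 : ℂ) R) :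
    termSum (neuTerm T) σ = (1 - termSum T σ)⁻¹ := by
  have hP : ∀ k, TermData κ d R (piTerm T k) (piMaj m k) (piConst ρw k) := termData_piTerm h hw hR
  have hN : TermData κ d R (neuTerm T) (neuMaj m) (neuConst ρw) := termData_neumann h hw hR hρ hρ1
  ext i j
  have hfib : ∀ k, Summable fun l : Fin k → W => neuTerm T ⟨k, l⟩ σ i j :=
    fun k => (hP k).summable hw hR hσ i j
  have htot : Summable fun x : Σ k, Fin k → W => neuTerm T x σ i j := hN.summable hw hR hσ i j
  have hk : ∀ k, ∑' l : Fin k → W, neuTerm T ⟨k, l⟩ σ i j = (termSum T σ ^ k) i j := fun k => by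
    have e := congrFun (congrFun (termSum_piTerm h hw hR hσ k) i) j
    simpa only [termSum, neuTerm] using e
  change ∑' x, neuTerm T x σ i j = _
  rw [htot.tsum_sigma' hfib, tsum_congr hk]
  exact (hasSum_pow_apply hw (h.wrs_termSum hw hR hρ hσ) hρ1 i j).tsum_eq

/-- **END**: the (2.16)-shape bound for the INVERSE family, x∕σ-data explicit:
`WRS κ d ((1 − A σ)⁻¹ − (1 − A 0)⁻¹) (2(1 − ρ)⁻¹/R·‖σ‖)`, `A = termSum T` — by the sibling's `wrs_termSum_sub` applied
to the Neumann family BY NAME (compare `AnalyticWalkSum216.wrs_inv_termSum_sub`, which needs `IsUnit`∕`WRS` of the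
inverse at `σ = 0` as hypotheses: here they are consequences). [cite: Balaban1988RG2Cluster, (2.16)–(2.17) p.16] -/
theorem wrs_neumann_sub [Nonempty n] (h : TermData κ d R T m ρw) (hw : WeightHyp κ d) (hR : 0 < R) {ρ : ℝ}
    (hρ : ∑' w, ρw w ≤ ρ) (hρ1 : ρ < 1) {σ : ℂ} (hσ : σ ∈ ball (0 : ℂ) R) :
    WRS κ d ((1 - termSum T σ)⁻¹ - (1 - termSum T 0)⁻¹) (2 * (1 - ρ)⁻¹ / R * ‖σ‖) := by
  rw [← termSum_neumann h hw hR hρ hρ1 hσ, ← termSum_neumann h hw hR hρ hρ1 (mem_ball_self hR)]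
  exact (termData_neumann h hw hR hρ hρ1).wrs_termSum_sub hw hR (tsum_neuConst_le h hw hR hρ hρ1) hσ

/-! ## §4 Non-vacuity -/

/-- The hypotheses of `termSum_neumann` are jointly satisfiable: the sibling's example family (one bond, one walk,
`T(σ) = σ∕2`-sized data) with `ρ = 1/2`. [folklore] -/
example : TermData (n := Unit) 0 (fun _ _ => 0) 1 (neuTerm fun (_ : Unit) σ => fun _ _ => σ / 2)
    (neuMaj fun (_ : Unit) _ _ => (1 : ℝ) / 2) (neuConst fun (_ : Unit) => (1 : ℝ) / 2) := by
  have hw : WeightHyp (n := Unit) 0 (fun _ _ => 0) := ⟨le_rfl, fun _ => rfl, fun _ _ => le_rfl, fun _ _ _ => by simp⟩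
  have h : TermData (n := Unit) (W := Unit) 0 (fun _ _ => 0) 1 (fun _ σ => fun _ _ => σ / 2)
      (fun _ _ _ => 1 / 2) (fun _ => 1 / 2) :=
    { ha := fun _ _ _ => differentiableOn_id.div_const _
      hm := fun _ σ hσ _ _ => by
        rw [norm_div, RCLike.norm_ofNat]
        exact div_le_div_of_nonneg_right (mem_ball_zero_iff.1 hσ).le zero_le_two
      hrow := fun _ _ => by simp
      hρw := .of_finite }
  exact termData_neumann h hw one_pos (ρ := 1 / 2) (by simp) (by norm_num)

end

end Summit.QuantumFields.BalabanUV.Beta.AnalyticWalkSum216Neumann
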